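import Summits.CriticalPhenomena.SAWScalingLimit.Theses.SAWAsymptoticMorera

/-!
# Line `birth` — birth-certificate skeleton (BC3) for the crux `SAWAsymptoticMorera.BoundaryIdentification`

Crux item stmt-CriticalPhenomena-6858, rank 4 of `route-CriticalPhenomena-SAWAsymptoticMorera`
(sub-problem `SAWScalingLimit`).  The crux decl is FIXED and is concluded BY NAME by
`BoundaryIdentification_of` below:

  `BoundaryIdentification := AsymptoticMorera → InteriorRegularity → ObservableLimitFlat`

— conditional glue with content: distributional holomorphicity (r2) and interior sup-relative
equicontinuity/Harnack (r3) of the critical `ℤ²` mid-edge parafermion `F_δ` (σ = 5/8, rooted at a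
boundary vertex `a_δ → a = D.pt 0` with outside reference site `a'_δ`) imply the flat-`b`,
boundary-normalised form of Duminil-Copin–Smirnov's Conjecture 2 on `δℤ²`
(`ObservableLimitFlat`, the route's target, item stmt-6855).

## Architecture: cut at the INTERIOR-NORMALISATION milestone

The informal proof named in the item has two halves with different dangers (item docstring and the
refuter/grounder notes of 2026-08-15): (A) every subsequential limit `f` of the interior-normalised
`F_δ` is holomorphic (r2 + r3 + Weyl/Morera), the exact lattice boundary phase
`arg F_δ = −(5/8)·(outer normal)` passes to the Riemann–Hilbert condition `Im (f dz^{5/8}) = 0` on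
`∂Ω ∖ {a}`, and uniqueness of that homogeneous RH problem in the growth class at the root gives
`f = λ (φ′)^{5/8}`; (B) the flat lattice environment at `b` turns the interior normalisation into
the boundary normalisation `F_δ(z_δ)/F_δ(b_δ)` up to ONE universal lattice constant `C`
(Kennedy–Lawler lattice effects are the danger).  Half (A) is exactly the statement that INTERIOR
RATIOS converge,

  `InteriorRatioIdentification`:  `F_δ(z_δ)/F_δ(z'_δ) → (φ′(z₀)/φ′(z₀'))^{5/8}`

for interior edges `z_δ → z₀`, `z'_δ → z₀'` of an arbitrary Dobrushin domain rooted at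
`a_δ → D.pt 0` (`φ : Ω → ℍ`, `a ↦ ∞`; the ratio of `5/8`-powers is `exp ((5/8)(L z₀ − L z₀'))` for
ANY continuous logarithm `L` of `φ′/c`, so neither `b` nor a branch choice enters).  This is the
route's own named fallback target ("pivot the target to interior normalisation", KILL CRITERIA of
the route header), typed here for the first time.  The two registered stubs are the two halves:

* S1 `stub_interiorIdentification : AsymptoticMorera → InteriorRegularity → InteriorRatioIdentification`
  — half (A).  Intended proof: Arzelà–Ascoli on `F_δ / sup_{K₀} |F_δ|` (r3) gives continuous
  subsequential limits on compacts, non-trivial by Harnack; r2 + Weyl's lemma (mollified test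
  functions; tree template `Literature.Probability.Percolation.SmirnovContinuumLimitProofs.
  differentiableOn_of_forall_latticeTriangle`) makes them holomorphic; the boundary phase of the
  half-edge terms at boundary mid-edges is EXACT on `ℤ²` as on Hex (the winding of a self-avoiding
  polyline from `a'_δ` to a boundary half-edge is path-independent in a simply connected domain),
  and must be shown to pass to the limit in conformal coordinates: `G := (f ∘ φ⁻¹)·((φ⁻¹)′)^{5/8}`
  is real and continuous on `ℝ` (NO BOUNDARY LAYER — the research content); with the growth bound
  `G(w) = O(|w|^{1−η})` at `∞ = φ(a)` (a priori one-arm estimate at the root, the second research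
  input; in `Ω`-terms `|f| ≲ |φ|^{1−η}|φ′|^{5/8}`, a full power of room: `f ∼ |z−a|^{−5/4}` vs
  `|φ||φ′|^{5/8} ∼ |z−a|^{−9/4}` at a smooth root), Schwarz reflection + Liouville give `G ≡ λ ∈ ℝ`,
  i.e. `f = λ (φ′)^{5/8}`, the same for every subsequence up to the normalisation, whence ratio
  convergence along the full filter `𝓝[>] 0`.  Size: research-open (L+).
* S2 `stub_flatBoundaryNormalisation :
     AsymptoticMorera → InteriorRegularity → InteriorRatioIdentification → ObservableLimitFlat`
  — half (B): given interior identification, the single boundary half-edge term at the flat,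
  lattice-aligned bottom row near `b` (whose lattice environment is the exact half-lattice in the
  ball `B(b, r)`, hence δ-independent) is asymptotic to `C⁻¹ · f`-normalisation with ONE real
  constant `C ≠ 0` for all such domains: flat-edge boundary universality of the `5/8` boundary
  operator's lattice amplitude.  r2/r3 are kept as hypotheses (a boundary Harnack principle at flat
  lattice-aligned boundary pieces is the expected engine).  Size: research-open (L).

Composition (no `sorry`): `BoundaryIdentification_of h1 h2 := fun hAM hIR => h2 hAM hIR (h1 hAM hIR)`.

## Disproof used / negatives index

No `Disproof.lean`, idea or line exists on this crux (`ledger crux ls stmt-CriticalPhenomena-6858`: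
no workfiles, 2026-08-17), so no `_false_without_` obligation applies.  Negatives index
(`ledger negatives --problem CriticalPhenomena`): the hexagonal twin of the target,
`SAWDefectDecoherence.HexObservableLimit` (stmt-5420), was refuted by a boundary-corridor witness
(`Theorems/SAWDefectDecoherenceHexObservableLimitRefutation.lean`: the discretisation `Λ δ` was a
free parameter in the `o(1)`-collar, so a one-cell corridor relocates the conformal root).  Neither
stub here is an instance: the `ℤ²` statements use the CANONICAL discretisation
`discreteDomainGraph D.carrier δ` (the refutation's own repair (ii)), the carrier is a fixed Jordan
domain (locally connected boundary: no macroscopic corridor survives `δ → 0`), and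
`InteriorRatioIdentification` compares two interior values with the SAME root, so root-environment
factors `κ(δ)` cancel exactly (a width-one lattice pocket at the root multiplies `F_δ` by a constant).
The refuted all-`δ` tightness stmt-0772 is unrelated to this crux.

## BC3 probes (file `bc/birth_probes.lean` of the registering seat, 2026-08-17)

For each stub `S ∈ {stub_interiorIdentification, stub_flatBoundaryNormalisation}` the probes
`S → BoundaryIdentification` and `S → SAWScalingLimit` by
`first | exact? | simpa [S] | (unfold S; simpa) | aesop` (and with the crux / the milestone unfolded)
FAIL; `InteriorRatioIdentification` itself is neither `simp`/`aesop`-provable nor -refutable.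
Sorries: exactly 2 = the two `stub_*`; zero elsewhere.

Namespace `…Cruxes.BoundaryIdentification.Birth`; statements over tree vocabulary only
(`SAW.DomainSAW`, `SAW.criticalFugacity`, `meshDomain`, `discreteDomainGraph`, `zdGraph`,
`meshPoint`, `medialPoint`, `Literature.Probability.LatticeModels.winding`, `DobrushinDomain`,
`ConformalEquiv`, `UpperHalfPlane.upperHalfPlaneSet`) plus the two local abbreviations
`rootedHalfEdgeTerm` (= the `let H` of the route items, verbatim) and `rootedMidEdgeObservable`.
-/

noncomputable section

open scoped BigOperators Topology Classical
open Filter Set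

namespace Summit.CriticalPhenomena.SAWScalingLimit.Cruxes.BoundaryIdentification.Birth

open Summit.CriticalPhenomena.SAWScalingLimit.Theses.SAWAsymptoticMorera
  (ObservableLimitFlat AsymptoticMorera InteriorRegularity)

/-! ### Vocabulary of the line -/

/-- **The rooted critical half-edge term `H_δ(p, q)`** — verbatim the `let H` of the route items
`ObservableLimitFlat` / `AsymptoticMorera` / `InteriorRegularity`: the sum over self-avoiding walks
`γ : a → p` of `Ω_δ` not having used the edge `{p, q}`, of `e^{-i(5/8)W} x_c^{|γ|+1}`, `W` the
winding of the mesh polyline started at the outside reference site `a'` and continued by the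
half-edge from `p` to the midpoint of `{p, q}`. [cite: DuminilCopinSmirnov2012, Def. 1] -/
def rootedHalfEdgeTerm (Ω : Set ℂ) (δ : ℝ)
    (a a' p q : Literature.Probability.LatticeModels.Site 2) : ℂ :=
  ∑' γ : Literature.Probability.RandomPlanarGeometry.SAW.DomainSAW Ω δ a p,
    if s(p, q) ∈ γ.walk.edges then 0 else
      Complex.exp (-Complex.I * (5 / 8 : ℂ) *
          (Literature.Probability.LatticeModels.winding
              (Literature.Probability.LatticeModels.meshPoint δ a' ::
                  (γ.walk.support.map (Literature.Probability.LatticeModels.meshPoint δ)) ++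
                [Literature.Probability.LatticeModels.medialPoint δ s(p, q)]) : ℝ)) *
        (Literature.Probability.RandomPlanarGeometry.SAW.criticalFugacity : ℂ) ^ (γ.length + 1)

/-- **The rooted critical mid-edge parafermion `F_δ({p, q}) = H_δ(p, q) + H_δ(q, p)`** (walks
arriving at the middle of the edge from either endpoint), as in the route items.
[cite: DuminilCopinSmirnov2012, Def. 1] -/
def rootedMidEdgeObservable (Ω : Set ℂ) (δ : ℝ)
    (a a' p q : Literature.Probability.LatticeModels.Site 2) : ℂ :=
  rootedHalfEdgeTerm Ω δ a a' p q + rootedHalfEdgeTerm Ω δ a a' q p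

/-- **Interior ratio identification** (the milestone of the line; the route header's fallback
target "interior normalisation", typed): for every Dobrushin domain `D`, boundary roots
`a_δ → a = D.pt 0` (in `Ω_δ`, with an outside `ℤ²`-neighbour `a'_δ` fixing the reference
direction), interior edges `(z_δ, w_δ)`, `(z'_δ, w'_δ)` of `Ω_δ` with `δ z_δ → z₀ ∈ Ω`,
`δ z'_δ → z₀' ∈ Ω`, every conformal `Φ : Ω → ℍ` with `a ↦ ∞` and every continuous logarithm `L`
of `Φ′/c` (`c ≠ 0`), the ratio of the critical mid-edge parafermions converges:
`F_δ(z_δ,w_δ) / F_δ(z'_δ,w'_δ) → exp ((5/8)(L z₀ − L z₀')) = (Φ′(z₀)/Φ′(z₀'))^{5/8}` as `δ → 0⁺`.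
(Independent of the choices of `Φ`, `L`, `c`: `Φ` is unique up to real affine maps of `ℍ`.)
Conjectural: the interior half of DCS Conjecture 2 transposed to `ℤ²`.
[cite: DuminilCopinSmirnov2012, Conjecture 2] -/
def InteriorRatioIdentification : Prop :=
  ∀ (D : Literature.Probability.RandomPlanarGeometry.DobrushinDomain)
    (a a' z w z' w' : ℝ → Literature.Probability.LatticeModels.Site 2) (z₀ z₀' : ℂ)
    (Φ : Literature.Probability.RandomPlanarGeometry.ConformalEquiv D.carrier
      UpperHalfPlane.upperHalfPlaneSet)
    (L : ℂ → ℂ) (c : ℂ),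
    (∀ᶠ δ in 𝓝[>] (0 : ℝ),
        a δ ∈ Literature.Probability.LatticeModels.meshDomain D.carrier δ ∧
          (Literature.Probability.LatticeModels.zdGraph 2).Adj (a δ) (a' δ) ∧
          Literature.Probability.LatticeModels.meshPoint δ (a' δ) ∉ D.carrier ∧
          (Literature.Probability.LatticeModels.discreteDomainGraph D.carrier δ).Adj (z δ) (w δ) ∧
          (Literature.Probability.LatticeModels.discreteDomainGraph D.carrier δ).Adj (z' δ) (w' δ)) →
    Tendsto (fun δ => Literature.Probability.LatticeModels.meshPoint δ (a δ))
      (𝓝[>] (0 : ℝ)) (𝓝 (D.pt 0)) →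
    z₀ ∈ D.carrier →
    Tendsto (fun δ => Literature.Probability.LatticeModels.meshPoint δ (z δ)) (𝓝[>] (0 : ℝ)) (𝓝 z₀) →
    z₀' ∈ D.carrier →
    Tendsto (fun δ => Literature.Probability.LatticeModels.meshPoint δ (z' δ)) (𝓝[>] (0 : ℝ)) (𝓝 z₀') →
    Tendsto (fun x => ‖Φ x‖) (𝓝[D.carrier] (D.pt 0)) atTop →
    ContinuousOn L D.carrier → c ≠ 0 → (∀ x ∈ D.carrier, Complex.exp (L x) = deriv Φ x / c) →
    Tendsto
      (fun δ => rootedMidEdgeObservable D.carrier δ (a δ) (a' δ) (z δ) (w δ) /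
        rootedMidEdgeObservable D.carrier δ (a δ) (a' δ) (z' δ) (w' δ))
      (𝓝[>] (0 : ℝ)) (𝓝 (Complex.exp ((5 / 8 : ℂ) * (L z₀ - L z₀'))))

/-! ### The stubs (the ONLY `sorry`s of the file) -/

/-- **S1 — interior identification** (half (A) of the crux: Weyl holomorphy of subsequential
limits from r2 + r3, passage of the exact lattice boundary phase to `Im (f dz^{5/8}) = 0` without a
boundary layer, growth class at the root, Schwarz reflection + Liouville in `ℍ`-coordinates).
Research-open; NOT implied by the crux cheaply (BC3 probes) and not the crux (its conclusion is the
interior milestone, not the route target). [conjecture] -/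
theorem stub_interiorIdentification :
    AsymptoticMorera → InteriorRegularity → InteriorRatioIdentification := by
  sorry

/-- **S2 — flat-edge boundary normalisation** (half (B) of the crux: given interior
identification, the boundary half-edge term on the flat lattice-aligned bottom row at `b` is
normalised by ONE universal real lattice constant `C ≠ 0` — flat-edge boundary universality of the
`5/8` boundary amplitude; Kennedy–Lawler lattice effects are the danger).  Research-open.
[conjecture] -/
theorem stub_flatBoundaryNormalisation :
    AsymptoticMorera → InteriorRegularity → InteriorRatioIdentification → ObservableLimitFlat := by
  sorry

/-! ### Name-keyed aliases of the stub statements (skeleton-check convention: the hypotheses of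
`BoundaryIdentification_of` are exactly the declared stubs, each BY NAME) -/

namespace Registered

/-- Alias keyed by the stub name: the statement of `stub_interiorIdentification`. -/
abbrev stub_interiorIdentification : Prop :=
  AsymptoticMorera → InteriorRegularity → InteriorRatioIdentification

/-- Alias keyed by the stub name: the statement of `stub_flatBoundaryNormalisation`. -/
abbrev stub_flatBoundaryNormalisation : Prop :=
  AsymptoticMorera → InteriorRegularity → InteriorRatioIdentification → ObservableLimitFlat

end Registered

/-- Consistency: each alias IS its stub's statement (definitionally). -/
example : Registered.stub_interiorIdentification := stub_interiorIdentification
example : Registered.stub_flatBoundaryNormalisation := stub_flatBoundaryNormalisation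

/-! ### The skeleton theorem: the two stubs imply the crux, BY NAME -/

/-- **`BoundaryIdentification` from the line `birth`** (kernel-checked, no `sorry` of its own):
interior identification (S1) produces the milestone `InteriorRatioIdentification` from r2 and r3,
and the flat-edge normalisation (S2) turns it into the route target `ObservableLimitFlat`.
Hypotheses = the two stubs under their registered names; conclusion = the route's crux decl, by
name. -/
theorem BoundaryIdentification_of (h1 : Registered.stub_interiorIdentification)
    (h2 : Registered.stub_flatBoundaryNormalisation) :
    Summit.CriticalPhenomena.SAWScalingLimit.Theses.SAWAsymptoticMorera.BoundaryIdentification :=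
  fun hAM hIR => h2 hAM hIR (h1 hAM hIR)

/-- Wiring check (an `example`, so that only ONE declaration of the file concludes the crux): the
sorried stub theorems are exactly the hypotheses of `BoundaryIdentification_of`; discharging the
two `sorry`s above turns this term into the crux proof. -/
example : Summit.CriticalPhenomena.SAWScalingLimit.Theses.SAWAsymptoticMorera.BoundaryIdentification :=
  BoundaryIdentification_of stub_interiorIdentification stub_flatBoundaryNormalisation

end Summit.CriticalPhenomena.SAWScalingLimit.Cruxes.BoundaryIdentification.Birth

end
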